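import Summits.AtomisticToContinuum.HydrodynamicLimit.Theorems.CollisionIsometryCLTAdaptedWeightCLTBHDVTransferHellinger
import Literature.Analysis.FunctionSpaces.SquaredBessel

/-!
# Stub `stub_contactToMass` (S4) of the line `block-h-dissipation-closure`, helper file 6: the Hellinger
numerator is uniformly continuous in the flux-weighted Hellinger distance of the pair laws
(crux `CollisionIsometryCLT.AdaptedWeightCLT`, stmt-AtomisticToContinuum-14868; `--supports`, anchor
`bhContactToMass_modulus_anchor`)

THE MODULUS OF THE CHARGING ARGUMENT. Write `𝒩(f) = ∫ B (√(f′f′_*) − √(f f_*))²` for the numerator of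
`hellDiss f = (2 Z(f))⁻¹ 𝒩(f)`. As a function of the pair amplitude `F = √(f f_*)` on `PairDir`, `√𝒩` is the
`L²(B dv dv_* dω)`-norm of `F∘T − F`, `T` the flux- and measure-preserving pre/post involution
(`(v, v_*, ω) ↦ (v_*′, v′, ω)`, `measurePreserving_collideSwap_prod`, `DVTransfer.hardSphereKernel_collideSwap`); hence
the TRIANGLE INEQUALITY
  `√𝒩(f₁) ≤ √𝒩(f₂) + 2 · √(∫ B (√(f₁f₁_*) − √(f₂f₂_*))²)`                    (`sqrt_lintegral_hellNum_le`)
(Minkowski in `L²`, `ENNReal.lintegral_Lp_add_le`, stated with lower Lebesgue integrals so that no integrability is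
needed), together with the pointwise bound
  `(√(ab) − √(cd))² ≤ 2b|a − c| + 2c|b − d|`                                      (`sq_sqrt_mul_sub_le`)
that turns the right-hand distance into a flux-weighted `L¹` distance of `f₁, f₂`. CONSEQUENCE FOR S4: moving a
mass fraction `α` of a cell law changes `√𝒩` by `O(√α)` — and NOT better in general: one contact that deposits a
particle at a velocity which is a collision PRODUCT of two populated velocities lowers `𝒩` at first order in `√α`
(the cross term `⟨E, F∘T⟩`), so `𝒟h ∘ cellLaw` has no `O(α)`-per-contact Lipschitz bound, only this global
Hölder-`½` modulus in the moved (flux-weighted) mass; the charging argument must therefore partition time by a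
fixed MOVED-MASS budget (uniform modulus), not by kinetic windows (on which `𝒟h` varies by `O(1)`).
No definitions.
-/

namespace Summit.AtomisticToContinuum.HydrodynamicLimit.Theorems.BlockHDissipation

open scoped BigOperators Topology Classical MeasureTheory ENNReal InnerProductSpace
open Filter Set MeasureTheory
open Literature.Analysis.FluidPDE
open Summit.AtomisticToContinuum.HydrodynamicLimit.Theorems.ContactSourceDuhamel (T3 V3 Cfg Vel Flow Flows)
open Literature.MathematicalPhysics.KineticTheory (collide hardSphereKernel sphereMeasure)

noncomputable section

namespace ContactToMass

/-! ## Pointwise inequalities -/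

/-- **`(√(ab) − √(cd))² ≤ 2b|a − c| + 2c|b − d|`** for `a, b, c, d ≥ 0` (split through `√(cb)`). -/
theorem sq_sqrt_mul_sub_le {a b c d : ℝ} (ha : 0 ≤ a) (hb : 0 ≤ b) (hc : 0 ≤ c) (hd : 0 ≤ d) :
    (Real.sqrt (a * b) - Real.sqrt (c * d)) ^ 2 ≤ 2 * b * |a - c| + 2 * c * |b - d| := by
  rw [Real.sqrt_mul ha, Real.sqrt_mul hc]
  -- `(√x − √y)² ≤ |x − y|` (tree: `Literature.Analysis.FunctionSpaces.sq_sqrt_sub_sqrt_le`)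
  have h1 := Literature.Analysis.FunctionSpaces.sq_sqrt_sub_sqrt_le ha hc
  have h2 := Literature.Analysis.FunctionSpaces.sq_sqrt_sub_sqrt_le hb hd
  have hsb := Real.sq_sqrt hb
  have hsc := Real.sq_sqrt hc
  -- `(x y − z w)² = ((x − z) y + z (y − w))² ≤ 2 (x−z)² y² + 2 z² (y−w)²`
  have key : (Real.sqrt a * Real.sqrt b - Real.sqrt c * Real.sqrt d) ^ 2 ≤
      2 * ((Real.sqrt a - Real.sqrt c) ^ 2 * Real.sqrt b ^ 2) + 2 * (Real.sqrt c ^ 2 * (Real.sqrt b - Real.sqrt d) ^ 2) := by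
    nlinarith [sq_nonneg ((Real.sqrt a - Real.sqrt c) * Real.sqrt b - Real.sqrt c * (Real.sqrt b - Real.sqrt d))]
  rw [hsb, hsc] at key
  have h3 : (Real.sqrt a - Real.sqrt c) ^ 2 * b ≤ |a - c| * b := mul_le_mul_of_nonneg_right h1 hb
  have h4 : c * (Real.sqrt b - Real.sqrt d) ^ 2 ≤ c * |b - d| := mul_le_mul_of_nonneg_left h2 hc
  nlinarith [h3, h4]

/-- The numerator's integrand as a square: `B d² = (√B · |d|)²`. -/
theorem kernel_mul_sq_eq (B d : ℝ) (hB : 0 ≤ B) : B * d ^ 2 = (Real.sqrt B * |d|) ^ 2 := by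
  rw [mul_pow, Real.sq_sqrt hB, sq_abs]

/-! ## Minkowski assembly -/

section Minkowski

variable {f₁ f₂ : V3 → ℝ}

/-- The `ℝ≥0∞`-valued amplitude `q ↦ ofReal (√B(q) · |√(f₁f₁)(p q) − √(f₂f₂)(p q)|)` is measurable for a continuous
choice of the pair `p q` (identity or collision map). -/
theorem measurable_amp {f₁ f₂ : V3 → ℝ} (hf₁ : Measurable f₁) (hf₂ : Measurable f₂) {p : PairDir → V3 × V3}
    (hp : Measurable p) :
    Measurable fun q : PairDir => ENNReal.ofReal (Real.sqrt (hardSphereKernel q.1 q.2) *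
      |Real.sqrt (f₁ (p q).1 * f₁ (p q).2) - Real.sqrt (f₂ (p q).1 * f₂ (p q).2)|) := by
  have hB : Measurable fun q : PairDir => hardSphereKernel q.1 q.2 :=
    DVTransfer.continuous_hardSphereKernel_pairDir.measurable
  have hL : ∀ {f : V3 → ℝ}, Measurable f → Measurable fun q : PairDir => f (p q).1 * f (p q).2 := fun hf =>
    (hf.comp (measurable_fst.comp hp)).mul (hf.comp (measurable_snd.comp hp))
  exact (hB.sqrt.mul (((hL hf₁).sqrt.sub (hL hf₂).sqrt).abs)).ennreal_ofReal

/-- **Triangle inequality for the Hellinger numerator** (lower Lebesgue integrals, exponent `½`): for measurable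
`f₁, f₂` (no sign or integrability condition),
`(∫⁻ B (√G₁ − √L₁)²)^{1/2} ≤ (∫⁻ B (√G₂ − √L₂)²)^{1/2} + 2 (∫⁻ B (√L₁ − √L₂)²)^{1/2}`,
`L_i = f_i(v) f_i(v_*)`, `G_i = f_i(v′) f_i(v_*′)`. -/
theorem sqrt_lintegral_hellNum_le (hf₁ : Measurable f₁) (hf₂ : Measurable f₂) :
    (∫⁻ q : PairDir, ENNReal.ofReal (hardSphereKernel q.1 q.2 *
        (Real.sqrt (f₁ (collide q.2 q.1).1 * f₁ (collide q.2 q.1).2) - Real.sqrt (f₁ q.1.1 * f₁ q.1.2)) ^ 2)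
        ∂pairDirMeasure) ^ (1 / 2 : ℝ) ≤
      (∫⁻ q : PairDir, ENNReal.ofReal (hardSphereKernel q.1 q.2 *
        (Real.sqrt (f₂ (collide q.2 q.1).1 * f₂ (collide q.2 q.1).2) - Real.sqrt (f₂ q.1.1 * f₂ q.1.2)) ^ 2)
        ∂pairDirMeasure) ^ (1 / 2 : ℝ) +
      2 * (∫⁻ q : PairDir, ENNReal.ofReal (hardSphereKernel q.1 q.2 *
        (Real.sqrt (f₁ q.1.1 * f₁ q.1.2) - Real.sqrt (f₂ q.1.1 * f₂ q.1.2)) ^ 2) ∂pairDirMeasure) ^ (1 / 2 : ℝ) := by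
  -- the four amplitudes as `ℝ≥0∞`-valued functions `√B · |·|`
  set a₁ : PairDir → ℝ≥0∞ := fun q => ENNReal.ofReal (Real.sqrt (hardSphereKernel q.1 q.2) *
    |Real.sqrt (f₁ (collide q.2 q.1).1 * f₁ (collide q.2 q.1).2) - Real.sqrt (f₁ q.1.1 * f₁ q.1.2)|) with ha₁
  set a₂ : PairDir → ℝ≥0∞ := fun q => ENNReal.ofReal (Real.sqrt (hardSphereKernel q.1 q.2) *
    |Real.sqrt (f₂ (collide q.2 q.1).1 * f₂ (collide q.2 q.1).2) - Real.sqrt (f₂ q.1.1 * f₂ q.1.2)|) with ha₂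
  set eG : PairDir → ℝ≥0∞ := fun q => ENNReal.ofReal (Real.sqrt (hardSphereKernel q.1 q.2) *
    |Real.sqrt (f₁ (collide q.2 q.1).1 * f₁ (collide q.2 q.1).2) -
      Real.sqrt (f₂ (collide q.2 q.1).1 * f₂ (collide q.2 q.1).2)|) with heG
  set eL : PairDir → ℝ≥0∞ := fun q => ENNReal.ofReal (Real.sqrt (hardSphereKernel q.1 q.2) *
    |Real.sqrt (f₁ q.1.1 * f₁ q.1.2) - Real.sqrt (f₂ q.1.1 * f₂ q.1.2)|) with heL
  have hB0 : ∀ q : PairDir, 0 ≤ hardSphereKernel q.1 q.2 := fun q => le_max_right _ _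
  -- rewrite the three integrands as squares of the amplitudes
  have hsq : ∀ (q : PairDir) (d : ℝ), ENNReal.ofReal (hardSphereKernel q.1 q.2 * d ^ 2) =
      ENNReal.ofReal (Real.sqrt (hardSphereKernel q.1 q.2) * |d|) ^ (2 : ℝ) := by
    intro q d
    rw [kernel_mul_sq_eq _ _ (hB0 q), ENNReal.ofReal_pow (mul_nonneg (Real.sqrt_nonneg _) (abs_nonneg _)),
      ← ENNReal.rpow_natCast]
    norm_num
  have hI₁ : (∫⁻ q : PairDir, ENNReal.ofReal (hardSphereKernel q.1 q.2 *
      (Real.sqrt (f₁ (collide q.2 q.1).1 * f₁ (collide q.2 q.1).2) - Real.sqrt (f₁ q.1.1 * f₁ q.1.2)) ^ 2)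
      ∂pairDirMeasure) = ∫⁻ q, a₁ q ^ (2 : ℝ) ∂pairDirMeasure := lintegral_congr fun q => hsq q _
  have hI₂ : (∫⁻ q : PairDir, ENNReal.ofReal (hardSphereKernel q.1 q.2 *
      (Real.sqrt (f₂ (collide q.2 q.1).1 * f₂ (collide q.2 q.1).2) - Real.sqrt (f₂ q.1.1 * f₂ q.1.2)) ^ 2)
      ∂pairDirMeasure) = ∫⁻ q, a₂ q ^ (2 : ℝ) ∂pairDirMeasure := lintegral_congr fun q => hsq q _
  have hIL : (∫⁻ q : PairDir, ENNReal.ofReal (hardSphereKernel q.1 q.2 *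
      (Real.sqrt (f₁ q.1.1 * f₁ q.1.2) - Real.sqrt (f₂ q.1.1 * f₂ q.1.2)) ^ 2) ∂pairDirMeasure) =
      ∫⁻ q, eL q ^ (2 : ℝ) ∂pairDirMeasure := lintegral_congr fun q => hsq q _
  rw [hI₁, hI₂, hIL]
  -- measurability
  have hc : Measurable fun q : PairDir => collide q.2 q.1 := continuous_collide_uncurry.measurable
  have hid : Measurable fun q : PairDir => q.1 := measurable_fst
  have ma₂ : Measurable a₂ := by
    have hB : Measurable fun q : PairDir => hardSphereKernel q.1 q.2 :=
      DVTransfer.continuous_hardSphereKernel_pairDir.measurable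
    exact (hB.sqrt.mul ((((hf₂.comp (measurable_fst.comp hc)).mul (hf₂.comp (measurable_snd.comp hc))).sqrt.sub
      ((hf₂.comp (measurable_fst.comp hid)).mul (hf₂.comp (measurable_snd.comp hid))).sqrt).abs)).ennreal_ofReal
  have meG : Measurable eG := measurable_amp hf₁ hf₂ hc
  have meL : Measurable eL := measurable_amp hf₁ hf₂ hid
  -- pointwise triangle inequality `a₁ ≤ a₂ + eG + eL`
  have hpt : ∀ q, a₁ q ≤ (a₂ + eG + eL) q := by
    intro q
    simp only [ha₁, ha₂, heG, heL, Pi.add_apply]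
    have hs : 0 ≤ Real.sqrt (hardSphereKernel q.1 q.2) := Real.sqrt_nonneg _
    set g₁ := Real.sqrt (f₁ (collide q.2 q.1).1 * f₁ (collide q.2 q.1).2)
    set g₂ := Real.sqrt (f₂ (collide q.2 q.1).1 * f₂ (collide q.2 q.1).2)
    set l₁ := Real.sqrt (f₁ q.1.1 * f₁ q.1.2)
    set l₂ := Real.sqrt (f₂ q.1.1 * f₂ q.1.2)
    have e1 : g₁ - l₁ = (g₂ - l₂) + ((g₁ - g₂) - (l₁ - l₂)) := by ring
    have hreal : |g₁ - l₁| ≤ |g₂ - l₂| + |g₁ - g₂| + |l₁ - l₂| :=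
      calc |g₁ - l₁| = |(g₂ - l₂) + ((g₁ - g₂) - (l₁ - l₂))| := by rw [← e1]
        _ ≤ |g₂ - l₂| + |(g₁ - g₂) - (l₁ - l₂)| := abs_add_le _ _
        _ ≤ |g₂ - l₂| + (|g₁ - g₂| + |l₁ - l₂|) := add_le_add le_rfl (abs_sub _ _)
        _ = _ := by ring
    rw [← ENNReal.ofReal_add (mul_nonneg hs (abs_nonneg _)) (mul_nonneg hs (abs_nonneg _)),
      ← ENNReal.ofReal_add (add_nonneg (mul_nonneg hs (abs_nonneg _)) (mul_nonneg hs (abs_nonneg _)))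
        (mul_nonneg hs (abs_nonneg _))]
    refine ENNReal.ofReal_le_ofReal ?_
    have := mul_le_mul_of_nonneg_left hreal hs
    nlinarith [this]
  -- monotonicity of `x ↦ (∫⁻ x²)^{1/2}`
  have h2 : (0 : ℝ) ≤ 2 := by norm_num
  have hhalf : (0 : ℝ) ≤ 1 / 2 := by norm_num
  have hmono : (∫⁻ q, a₁ q ^ (2 : ℝ) ∂pairDirMeasure) ^ (1 / 2 : ℝ) ≤
      (∫⁻ q, (a₂ + eG + eL) q ^ (2 : ℝ) ∂pairDirMeasure) ^ (1 / 2 : ℝ) :=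
    ENNReal.rpow_le_rpow (lintegral_mono fun q => ENNReal.rpow_le_rpow (hpt q) h2) hhalf
  -- Minkowski, twice
  have hM1 : (∫⁻ q, (a₂ + eG + eL) q ^ (2 : ℝ) ∂pairDirMeasure) ^ (1 / 2 : ℝ) ≤
      (∫⁻ q, (a₂ + eG) q ^ (2 : ℝ) ∂pairDirMeasure) ^ (1 / 2 : ℝ) +
        (∫⁻ q, eL q ^ (2 : ℝ) ∂pairDirMeasure) ^ (1 / 2 : ℝ) :=
    ENNReal.lintegral_Lp_add_le (ma₂.add meG).aemeasurable meL.aemeasurable (by norm_num)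
  have hM2 : (∫⁻ q, (a₂ + eG) q ^ (2 : ℝ) ∂pairDirMeasure) ^ (1 / 2 : ℝ) ≤
      (∫⁻ q, a₂ q ^ (2 : ℝ) ∂pairDirMeasure) ^ (1 / 2 : ℝ) +
        (∫⁻ q, eG q ^ (2 : ℝ) ∂pairDirMeasure) ^ (1 / 2 : ℝ) :=
    ENNReal.lintegral_Lp_add_le ma₂.aemeasurable meG.aemeasurable (by norm_num)
  -- the gain distance IS the loss distance (flux-preserving involution)
  have hT : MeasurePreserving (fun q : PairDir => ((collide q.2 q.1).swap, q.2)) pairDirMeasure pairDirMeasure :=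
    measurePreserving_collideSwap_prod (E := V3)
  have hGL : ∫⁻ q, eG q ^ (2 : ℝ) ∂pairDirMeasure = ∫⁻ q, eL q ^ (2 : ℝ) ∂pairDirMeasure := by
    have hcomp : ∀ q : PairDir, eG q = eL ((collide q.2 q.1).swap, q.2) := by
      intro q
      simp only [heG, heL, Prod.fst_swap, Prod.snd_swap, DVTransfer.hardSphereKernel_collideSwap]
      rw [mul_comm (f₁ (collide q.2 q.1).2), mul_comm (f₂ (collide q.2 q.1).2)]
    have h := hT.lintegral_comp (meL.pow_const (2 : ℝ))
    rw [← h]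
    exact lintegral_congr fun q => by rw [hcomp q]
  -- assemble
  calc (∫⁻ q, a₁ q ^ (2 : ℝ) ∂pairDirMeasure) ^ (1 / 2 : ℝ)
      ≤ (∫⁻ q, (a₂ + eG + eL) q ^ (2 : ℝ) ∂pairDirMeasure) ^ (1 / 2 : ℝ) := hmono
    _ ≤ (∫⁻ q, a₂ q ^ (2 : ℝ) ∂pairDirMeasure) ^ (1 / 2 : ℝ) +
          (∫⁻ q, eG q ^ (2 : ℝ) ∂pairDirMeasure) ^ (1 / 2 : ℝ) +
          (∫⁻ q, eL q ^ (2 : ℝ) ∂pairDirMeasure) ^ (1 / 2 : ℝ) := hM1.trans (add_le_add hM2 le_rfl)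
    _ = (∫⁻ q, a₂ q ^ (2 : ℝ) ∂pairDirMeasure) ^ (1 / 2 : ℝ) +
          2 * (∫⁻ q, eL q ^ (2 : ℝ) ∂pairDirMeasure) ^ (1 / 2 : ℝ) := by rw [hGL, two_mul, add_assoc]

/-! ## The loss distance against a flux-weighted `L¹` distance -/

/-- `B(v − v_*, ω) ≤ ‖v − u‖ + ‖v_* − u‖` for every reference velocity `u`. -/
theorem hardSphereKernel_le_norm_add (p : V3 × V3) (ω : Metric.sphere (0 : V3) 1) (u : V3) :
    hardSphereKernel p ω ≤ ‖p.1 - u‖ + ‖p.2 - u‖ := by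
  unfold hardSphereKernel
  refine max_le ?_ (by positivity)
  calc ⟪p.1 - p.2, (ω : V3)⟫_ℝ ≤ ‖p.1 - p.2‖ * ‖(ω : V3)‖ := real_inner_le_norm _ _
    _ = ‖p.1 - p.2‖ := by rw [norm_eq_of_mem_sphere ω, mul_one]
    _ = ‖(p.1 - u) - (p.2 - u)‖ := by congr 1; abel
    _ ≤ ‖p.1 - u‖ + ‖p.2 - u‖ := norm_sub_le _ _

/-- Pointwise: `B (√L₁ − √L₂)² ≤ 2 (‖v−u‖ + ‖v_*−u‖) (f₁(v_*) |f₁(v) − f₂(v)| + f₂(v) |f₁(v_*) − f₂(v_*)|)` for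
`f₁, f₂ ≥ 0`. -/
theorem kernel_mul_lossDist_sq_le (h₁ : ∀ v, 0 ≤ f₁ v) (h₂ : ∀ v, 0 ≤ f₂ v) (q : PairDir) (u : V3) :
    hardSphereKernel q.1 q.2 * (Real.sqrt (f₁ q.1.1 * f₁ q.1.2) - Real.sqrt (f₂ q.1.1 * f₂ q.1.2)) ^ 2 ≤
      2 * (‖q.1.1 - u‖ + ‖q.1.2 - u‖) *
        (f₁ q.1.2 * |f₁ q.1.1 - f₂ q.1.1| + f₂ q.1.1 * |f₁ q.1.2 - f₂ q.1.2|) := by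
  have hB0 : 0 ≤ hardSphereKernel q.1 q.2 := le_max_right _ _
  have hB := hardSphereKernel_le_norm_add q.1 q.2 u
  have hsq := sq_sqrt_mul_sub_le (h₁ q.1.1) (h₁ q.1.2) (h₂ q.1.1) (h₂ q.1.2)
  have hR : 0 ≤ f₁ q.1.2 * |f₁ q.1.1 - f₂ q.1.1| + f₂ q.1.1 * |f₁ q.1.2 - f₂ q.1.2| := by
    have := h₁ q.1.2; have := h₂ q.1.1; positivity
  calc hardSphereKernel q.1 q.2 * (Real.sqrt (f₁ q.1.1 * f₁ q.1.2) - Real.sqrt (f₂ q.1.1 * f₂ q.1.2)) ^ 2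
      ≤ hardSphereKernel q.1 q.2 * (2 * f₁ q.1.2 * |f₁ q.1.1 - f₂ q.1.1| + 2 * f₂ q.1.1 * |f₁ q.1.2 - f₂ q.1.2|) :=
        mul_le_mul_of_nonneg_left hsq hB0
    _ = hardSphereKernel q.1 q.2 * (2 * (f₁ q.1.2 * |f₁ q.1.1 - f₂ q.1.1| + f₂ q.1.1 * |f₁ q.1.2 - f₂ q.1.2|)) := by
        ring
    _ ≤ (‖q.1.1 - u‖ + ‖q.1.2 - u‖) * (2 * (f₁ q.1.2 * |f₁ q.1.1 - f₂ q.1.1| + f₂ q.1.1 * |f₁ q.1.2 - f₂ q.1.2|)) :=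
        mul_le_mul_of_nonneg_right hB (by positivity)
    _ = _ := by ring

/-- A product `φ(v) ψ(v_*)` (constant in `ω`) integrates over `PairDir` to `|S²| · ∫φ · ∫ψ` (lower integrals). -/
theorem lintegral_pairDir_prod {φ χ : V3 → ℝ≥0∞} (hφ : Measurable φ) (hχ : Measurable χ) :
    ∫⁻ q : PairDir, φ q.1.1 * χ q.1.2 ∂pairDirMeasure =
      sphereMeasure (Set.univ : Set (Metric.sphere (0 : V3) 1)) * ((∫⁻ v, φ v) * ∫⁻ v, χ v) := by
  haveI := isFiniteMeasure_sphereMeasure (E := V3)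
  rw [DVTransfer.pairDirMeasure_eq]
  have hm : AEMeasurable (fun q : PairDir => φ q.1.1 * χ q.1.2)
      (((volume : Measure V3).prod volume).prod sphereMeasure) :=
    ((hφ.comp (measurable_fst.comp measurable_fst)).mul (hχ.comp (measurable_snd.comp measurable_fst))).aemeasurable
  rw [lintegral_prod _ hm]
  simp only [lintegral_const]
  have hmeas : Measurable fun x : V3 × V3 => φ x.1 * χ x.2 := (hφ.comp measurable_fst).mul (hχ.comp measurable_snd)
  rw [lintegral_mul_const _ hmeas, lintegral_prod_mul hφ.aemeasurable hχ.aemeasurable, mul_comm]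

/-- **The loss distance is dominated by a flux-weighted `L¹` distance**: for measurable `f₁, f₂ ≥ 0` and every
reference velocity `u` (lower integrals; `Δ = |f₁ − f₂|`),
`∫⁻ B (√L₁ − √L₂)² ≤ 2|S²| · [ ∫‖·−u‖Δ · ∫f₁ + ∫Δ · ∫‖·−u‖f₁ + ∫‖·−u‖f₂ · ∫Δ + ∫f₂ · ∫‖·−u‖Δ ]`. -/
theorem lintegral_lossDist_le (hf₁ : Measurable f₁) (hf₂ : Measurable f₂) (h₁ : ∀ v, 0 ≤ f₁ v) (h₂ : ∀ v, 0 ≤ f₂ v)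
    (u : V3) :
    ∫⁻ q : PairDir, ENNReal.ofReal (hardSphereKernel q.1 q.2 *
        (Real.sqrt (f₁ q.1.1 * f₁ q.1.2) - Real.sqrt (f₂ q.1.1 * f₂ q.1.2)) ^ 2) ∂pairDirMeasure ≤
      2 * sphereMeasure (Set.univ : Set (Metric.sphere (0 : V3) 1)) *
        ((∫⁻ v, ENNReal.ofReal (‖v - u‖ * |f₁ v - f₂ v|)) * (∫⁻ v, ENNReal.ofReal (f₁ v)) +
          (∫⁻ v, ENNReal.ofReal |f₁ v - f₂ v|) * (∫⁻ v, ENNReal.ofReal (‖v - u‖ * f₁ v)) +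
          (∫⁻ v, ENNReal.ofReal (‖v - u‖ * f₂ v)) * (∫⁻ v, ENNReal.ofReal |f₁ v - f₂ v|) +
          (∫⁻ v, ENNReal.ofReal (f₂ v)) * (∫⁻ v, ENNReal.ofReal (‖v - u‖ * |f₁ v - f₂ v|))) := by
  -- the four product integrands
  set φ₁ : V3 → ℝ≥0∞ := fun v => ENNReal.ofReal (‖v - u‖ * |f₁ v - f₂ v|) with hφ₁
  set φ₂ : V3 → ℝ≥0∞ := fun v => ENNReal.ofReal |f₁ v - f₂ v| with hφ₂
  set χ₁ : V3 → ℝ≥0∞ := fun v => ENNReal.ofReal (f₁ v) with hχ₁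
  set χ₂ : V3 → ℝ≥0∞ := fun v => ENNReal.ofReal (‖v - u‖ * f₁ v) with hχ₂
  set χ₃ : V3 → ℝ≥0∞ := fun v => ENNReal.ofReal (‖v - u‖ * f₂ v) with hχ₃
  set χ₄ : V3 → ℝ≥0∞ := fun v => ENNReal.ofReal (f₂ v) with hχ₄
  have hΔ : Measurable fun v => |f₁ v - f₂ v| := (hf₁.sub hf₂).abs
  have hnu : Measurable fun v : V3 => ‖v - u‖ := (measurable_id.sub_const u).norm
  have mφ₁ : Measurable φ₁ := (hnu.mul hΔ).ennreal_ofReal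
  have mφ₂ : Measurable φ₂ := hΔ.ennreal_ofReal
  have mχ₁ : Measurable χ₁ := hf₁.ennreal_ofReal
  have mχ₂ : Measurable χ₂ := (hnu.mul hf₁).ennreal_ofReal
  have mχ₃ : Measurable χ₃ := (hnu.mul hf₂).ennreal_ofReal
  have mχ₄ : Measurable χ₄ := hf₂.ennreal_ofReal
  -- pointwise domination by the sum of the four products
  have hpt : ∀ q : PairDir, ENNReal.ofReal (hardSphereKernel q.1 q.2 *
      (Real.sqrt (f₁ q.1.1 * f₁ q.1.2) - Real.sqrt (f₂ q.1.1 * f₂ q.1.2)) ^ 2) ≤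
      2 * (φ₁ q.1.1 * χ₁ q.1.2 + φ₂ q.1.1 * χ₂ q.1.2 + χ₃ q.1.1 * φ₂ q.1.2 + χ₄ q.1.1 * φ₁ q.1.2) := by
    intro q
    have h := kernel_mul_lossDist_sq_le h₁ h₂ q u
    have hv := h₁ q.1.2
    have hw := h₂ q.1.1
    have hn1 : 0 ≤ ‖q.1.1 - u‖ := norm_nonneg _
    have hn2 : 0 ≤ ‖q.1.2 - u‖ := norm_nonneg _
    have ha1 : 0 ≤ |f₁ q.1.1 - f₂ q.1.1| := abs_nonneg _
    have ha2 : 0 ≤ |f₁ q.1.2 - f₂ q.1.2| := abs_nonneg _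
    set S : ℝ := ‖q.1.1 - u‖ * |f₁ q.1.1 - f₂ q.1.1| * f₁ q.1.2 + |f₁ q.1.1 - f₂ q.1.1| * (‖q.1.2 - u‖ * f₁ q.1.2) +
      ‖q.1.1 - u‖ * f₂ q.1.1 * |f₁ q.1.2 - f₂ q.1.2| + f₂ q.1.1 * (‖q.1.2 - u‖ * |f₁ q.1.2 - f₂ q.1.2|) with hS
    have e1 : φ₁ q.1.1 * χ₁ q.1.2 = ENNReal.ofReal (‖q.1.1 - u‖ * |f₁ q.1.1 - f₂ q.1.1| * f₁ q.1.2) := by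
      simp only [hφ₁, hχ₁]
      rw [← ENNReal.ofReal_mul (by positivity)]
    have e2 : φ₂ q.1.1 * χ₂ q.1.2 = ENNReal.ofReal (|f₁ q.1.1 - f₂ q.1.1| * (‖q.1.2 - u‖ * f₁ q.1.2)) := by
      simp only [hφ₂, hχ₂]
      rw [← ENNReal.ofReal_mul (by positivity)]
    have e3 : χ₃ q.1.1 * φ₂ q.1.2 = ENNReal.ofReal (‖q.1.1 - u‖ * f₂ q.1.1 * |f₁ q.1.2 - f₂ q.1.2|) := by
      simp only [hφ₂, hχ₃]
      rw [← ENNReal.ofReal_mul (by positivity)]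
    have e4 : χ₄ q.1.1 * φ₁ q.1.2 = ENNReal.ofReal (f₂ q.1.1 * (‖q.1.2 - u‖ * |f₁ q.1.2 - f₂ q.1.2|)) := by
      simp only [hφ₁, hχ₄]
      rw [← ENNReal.ofReal_mul (by positivity)]
    have hS2 : (2 : ℝ≥0∞) * (φ₁ q.1.1 * χ₁ q.1.2 + φ₂ q.1.1 * χ₂ q.1.2 + χ₃ q.1.1 * φ₂ q.1.2 + χ₄ q.1.1 * φ₁ q.1.2) =
        ENNReal.ofReal (2 * S) := by
      rw [e1, e2, e3, e4, ← ENNReal.ofReal_add (by positivity) (by positivity),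
        ← ENNReal.ofReal_add (by positivity) (by positivity), ← ENNReal.ofReal_add (by positivity) (by positivity),
        hS, ENNReal.ofReal_mul (by norm_num : (0 : ℝ) ≤ 2), ENNReal.ofReal_ofNat]
    rw [hS2]
    refine ENNReal.ofReal_le_ofReal (h.trans (le_of_eq ?_))
    rw [hS]
    ring
  -- integrate
  calc ∫⁻ q : PairDir, ENNReal.ofReal (hardSphereKernel q.1 q.2 *
        (Real.sqrt (f₁ q.1.1 * f₁ q.1.2) - Real.sqrt (f₂ q.1.1 * f₂ q.1.2)) ^ 2) ∂pairDirMeasure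
      ≤ ∫⁻ q : PairDir, 2 * (φ₁ q.1.1 * χ₁ q.1.2 + φ₂ q.1.1 * χ₂ q.1.2 + χ₃ q.1.1 * φ₂ q.1.2 + χ₄ q.1.1 * φ₁ q.1.2)
          ∂pairDirMeasure := lintegral_mono hpt
    _ = 2 * ((∫⁻ q : PairDir, φ₁ q.1.1 * χ₁ q.1.2 ∂pairDirMeasure) +
          (∫⁻ q : PairDir, φ₂ q.1.1 * χ₂ q.1.2 ∂pairDirMeasure) +
          (∫⁻ q : PairDir, χ₃ q.1.1 * φ₂ q.1.2 ∂pairDirMeasure) +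
          (∫⁻ q : PairDir, χ₄ q.1.1 * φ₁ q.1.2 ∂pairDirMeasure)) := by
        have m1 : Measurable fun q : PairDir => φ₁ q.1.1 * χ₁ q.1.2 :=
          (mφ₁.comp (measurable_fst.comp measurable_fst)).mul (mχ₁.comp (measurable_snd.comp measurable_fst))
        have m2 : Measurable fun q : PairDir => φ₂ q.1.1 * χ₂ q.1.2 :=
          (mφ₂.comp (measurable_fst.comp measurable_fst)).mul (mχ₂.comp (measurable_snd.comp measurable_fst))
        have m3 : Measurable fun q : PairDir => χ₃ q.1.1 * φ₂ q.1.2 :=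
          (mχ₃.comp (measurable_fst.comp measurable_fst)).mul (mφ₂.comp (measurable_snd.comp measurable_fst))
        have m4 : Measurable fun q : PairDir => χ₄ q.1.1 * φ₁ q.1.2 :=
          (mχ₄.comp (measurable_fst.comp measurable_fst)).mul (mφ₁.comp (measurable_snd.comp measurable_fst))
        have m1234 : Measurable fun q : PairDir =>
            φ₁ q.1.1 * χ₁ q.1.2 + φ₂ q.1.1 * χ₂ q.1.2 + χ₃ q.1.1 * φ₂ q.1.2 + χ₄ q.1.1 * φ₁ q.1.2 :=
          ((m1.add m2).add m3).add m4
        rw [lintegral_const_mul _ m1234, lintegral_add_right _ m4, lintegral_add_right _ m3,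
          lintegral_add_right _ m2]
    _ = _ := by
        rw [lintegral_pairDir_prod mφ₁ mχ₁, lintegral_pairDir_prod mφ₂ mχ₂, lintegral_pairDir_prod mχ₃ mφ₂,
          lintegral_pairDir_prod mχ₄ mφ₁]
        ring

end Minkowski

end ContactToMass

/-- Registration anchor of this helper file (`--supports stmt-AtomisticToContinuum-14868`, stub
`stub_contactToMass`, file 6): the triangle inequality of the Hellinger numerator in the flux-weighted `L²`
distance of the pair amplitudes — the `∀`-closed form of `ContactToMass.sqrt_lintegral_hellNum_le`. -/
theorem bhContactToMass_modulus_anchor : ∀ (f₁ f₂ : V3 → ℝ), Measurable f₁ → Measurable f₂ →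
    (∫⁻ q : PairDir, ENNReal.ofReal (hardSphereKernel q.1 q.2 *
        (Real.sqrt (f₁ (collide q.2 q.1).1 * f₁ (collide q.2 q.1).2) - Real.sqrt (f₁ q.1.1 * f₁ q.1.2)) ^ 2)
        ∂pairDirMeasure) ^ (1 / 2 : ℝ) ≤
      (∫⁻ q : PairDir, ENNReal.ofReal (hardSphereKernel q.1 q.2 *
        (Real.sqrt (f₂ (collide q.2 q.1).1 * f₂ (collide q.2 q.1).2) - Real.sqrt (f₂ q.1.1 * f₂ q.1.2)) ^ 2)
        ∂pairDirMeasure) ^ (1 / 2 : ℝ) +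
      2 * (∫⁻ q : PairDir, ENNReal.ofReal (hardSphereKernel q.1 q.2 *
        (Real.sqrt (f₁ q.1.1 * f₁ q.1.2) - Real.sqrt (f₂ q.1.1 * f₂ q.1.2)) ^ 2) ∂pairDirMeasure) ^ (1 / 2 : ℝ) :=
  fun _ _ hf₁ hf₂ => ContactToMass.sqrt_lintegral_hellNum_le hf₁ hf₂

end

end Summit.AtomisticToContinuum.HydrodynamicLimit.Theorems.BlockHDissipation
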